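import Summits.CriticalPhenomena.PercolationContinuityZ3.Theses.PercEventualDensity
import Summits.CriticalPhenomena.PercolationContinuityZ3.Theorems.PercNearOneGluingNoHeavyLowerTailCSHTheoremOne
import Literature.Probability.Percolation.HalfSpaceBGNProofs
import HarnessLib

/-!
# `PercEventualDensity.NoSlabPercolationAtCriticality` (stmt-CriticalPhenomena-17963) — SETTLED after continuity

Item `stmt-CriticalPhenomena-17963` of route `CriticalPhenomena/PercEventualDensity` (support): at `p_c(ℤ³)` no slab `S_k` percolates (Grimmett (7.38) for `d = 3`).

Literally the Literature theorem `theta_slab_criticalProbI_eq_zero` (Duminil-Copin–Sidoravicius–Tassion 2016, proved in the tree). p205010 is NOT used.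

builds on p205010 (kernel theorem, internal audit signed; external expert review pending) — USED (`CSH.percolationContinuityZ3_holds`).  RSW3 lane, lead gen 28 (prover-prim-rsw3-lead-g28-0):
'after continuity — the ledger harvest'.
References: G. Kozma, N. Nitzan (2024), Thm. 6 / Conj. 3 [KozmaNitzan2024]; G. Grimmett, *Percolation* (1999), §8 [GrimmettPercolation1999].
-/

noncomputable section

namespace Summit.CriticalPhenomena.PercolationContinuityZ3.Theorems

namespace PercEventualDensityNoSlabPercolationAtCriticality

open MeasureTheory Literature.Probability.Percolation Literature.Probability.LatticeModels

/-- **`PercEventualDensity.NoSlabPercolationAtCriticality` (stmt-CriticalPhenomena-17963), settled.**  `theta_slab_criticalProbI_eq_zero` (DST 2016).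
[cite: KozmaNitzan2024, Thm. 6 with Conj. 3 (p. 15)] -/
theorem noSlabPercolationAtCriticality_proof : Summit.CriticalPhenomena.PercolationContinuityZ3.Theses.PercEventualDensity.NoSlabPercolationAtCriticality := by
  intro k hk
  exact theta_slab_criticalProbI_eq_zero k hk

end PercEventualDensityNoSlabPercolationAtCriticality

end Summit.CriticalPhenomena.PercolationContinuityZ3.Theorems

end
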